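/-
Fleet lead `ym-wcr-19609-p1` (seat prover-ym-wcr-19609-p1-g2-0), route `WeakCouplingRates`, crux `BulkDominatesColdBoxW`
(stmt-QuantumFields-19609), line `dlr-chessboard` (v6): generic MEAN bookkeeping for the assembly of `KernelMeanExpansion` (H-A1, mean form).
-/
import Summits.QuantumFields.YangMills.Theorems.WeakCouplingRatesColdBoxCovBookkeeping
import Summits.QuantumFields.YangMills.Theorems.WeakCouplingRatesColdBoxDirichletShiftedMean

/-!
# Crux `BulkDominatesColdBoxW`, stub `stub_kernelMeanExpansion`: MEAN bookkeeping — tilt + conditioning + surrogate in one inequality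

The mean twin of `abs_cov_tilted_cond_sub_cov_le` (`Theorems/WeakCouplingRatesColdBoxCovBookkeeping.lean`, seat ym-wcr-19456-p1): after the
representation of the box kernel (conditioned on its small-field event) as the tilt `ν = (γ[|S]).tilted (𝟙_S W)` of the mean-shifted Dirichlet
Gaussian `γ` conditioned on the Gaussian good event `S`, the kernel mean of a bounded observable `F` (`|F| ≤ M` on `S`) that is within `τ` of an
`L²(γ)` surrogate `Q` on `S` is the Gaussian mean of `Q` up to

  `|∫ F dν − ∫ Q dγ| ≤ M·(e^{2w} − 1) + τ + 2(1 + ∫ Q² dγ)·√p`     (`abs_mean_tilted_cond_sub_le`),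

`|𝟙_S W| ≤ w`, `γ(Sᶜ) ≤ p ≤ ½`.  Ingredients: `abs_integral_tilted_sub_le` (tilt), `abs_integral_sub_integral_cond_le_of_sq` (conditioning an `L²`
observable, seat ym-spine-20043-p1), and the surrogate step on `S`.  Pure measure theory; the assembler instantiates `γ =` shifted `boxDirichlet^{⊗3}`,
`S =` good event, `W =` tilt, `F = β·c_q ∘ chart`, `Q = ½Σ_c s_c(q)²` (read-out `integral_quadObs_datum_eq`).  No new definition; standard axioms.
NOT a claim about the mass gap.
-/

set_option autoImplicit false

noncomputable section

open MeasureTheory ProbabilityTheory Real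

namespace Summit.QuantumFields.YangMills.Theorems.WeakCouplingRates

variable {Ω : Type*} [MeasurableSpace Ω] {γ : Measure Ω} [IsProbabilityMeasure γ]

/-- **Mean bookkeeping.**  With `ν = (γ[|S]).tilted (𝟙_S W)`, `|𝟙_S W| ≤ w`, `|F| ≤ M` and `|F − Q| ≤ τ` on `S`, `Q ∈ L²(γ)`,
`γ(Sᶜ) ≤ p ≤ ½`, `γ(S) ≠ 0`:  `|∫ F dν − ∫ Q dγ| ≤ M(e^{2w} − 1) + τ + 2(1 + ∫Q² dγ)√p`. -/
theorem abs_mean_tilted_cond_sub_le {S : Set Ω} (hS : MeasurableSet S) (hS0 : γ S ≠ 0) {W : Ω → ℝ} (hWm : Measurable W)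
    {w : ℝ} (hW : ∀ ω, |S.indicator W ω| ≤ w) {F Q : Ω → ℝ} (hFm : Measurable F) (hQ : MemLp Q 2 γ)
    {M τ p : ℝ} (hM : 0 ≤ M) (hF : ∀ ω ∈ S, |F ω| ≤ M) (hFQ : ∀ ω ∈ S, |F ω - Q ω| ≤ τ)
    (hp : γ.real Sᶜ ≤ p) (hp2 : p ≤ 1 / 2) :
    |(∫ ω, F ω ∂((γ[|S]).tilted (S.indicator W))) - ∫ ω, Q ω ∂γ| ≤
      M * (exp (2 * w) - 1) + τ + 2 * (1 + ∫ ω, Q ω ^ 2 ∂γ) * Real.sqrt p := by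
  haveI : IsProbabilityMeasure (γ[|S]) := cond_isProbabilityMeasure hS0
  set μS := γ[|S] with hμS
  set ν := μS.tilted (S.indicator W) with hν
  set F' := S.indicator F with hF'
  have hF'm : Measurable F' := hFm.indicator hS
  have hF'b : ∀ ω, |F' ω| ≤ M := fun ω => by
    by_cases hω : ω ∈ S
    · rw [hF', Set.indicator_of_mem hω]; exact hF ω hω
    · rw [hF', Set.indicator_of_notMem hω, abs_zero]; exact hM
  -- both `ν` and `μS` live on `S`
  have hμSc : μS Sᶜ = 0 := cond_compl_eq_zero S hS
  have hνc : ν Sᶜ = 0 := (tilted_absolutelyContinuous μS _) hμSc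
  have haeF : ∀ {μ : Measure Ω}, μ Sᶜ = 0 → (fun ω => F ω) =ᵐ[μ] F' := fun {μ} hμ => by
    refine ae_iff.2 (measure_mono_null (fun ω hω => ?_) hμ)
    intro hωS; exact hω (by rw [hF', Set.indicator_of_mem hωS])
  have haeS : ∀ᵐ ω ∂μS, ω ∈ S := by
    rw [ae_iff]
    have : {a | ¬ a ∈ S} = Sᶜ := rfl
    rw [this]; exact hμSc
  -- (i) the tilt
  have hF'iS : Integrable F' μS := integrable_of_abs_le hF'm.aestronglyMeasurable hF'b
  have htilt : |(∫ ω, F' ω ∂ν) - ∫ ω, F' ω ∂μS| ≤ M * (exp (2 * w) - 1) :=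
    abs_integral_tilted_sub_le (ν := μS) (hWm.indicator hS) hW hF'iS hF'b
  have h1 : ∫ ω, F ω ∂ν = ∫ ω, F' ω ∂ν := integral_congr_ae (haeF hνc)
  have h2 : ∫ ω, F' ω ∂μS = ∫ ω, F ω ∂μS := (integral_congr_ae (haeF hμSc)).symm
  -- (ii) the surrogate on `S`
  have hQi : Integrable Q γ := hQ.integrable one_le_two
  have hQiS : Integrable Q μS := by
    rw [hμS, ProbabilityTheory.cond]
    exact (hQi.restrict (s := S)).smul_measure (ENNReal.inv_ne_top.2 hS0)
  have hFiS : Integrable F μS := (integrable_congr (haeF hμSc)).2 hF'iS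
  have hsur : |(∫ ω, F ω ∂μS) - ∫ ω, Q ω ∂μS| ≤ τ := by
    rw [← integral_sub hFiS hQiS]
    have hτ0 : 0 ≤ τ := by
      obtain ⟨ω, hω⟩ : ∃ ω, ω ∈ S := by
        by_contra h
        push Not at h
        apply hS0
        have : S = ∅ := Set.eq_empty_iff_forall_notMem.2 h
        rw [this, measure_empty]
      exact (abs_nonneg _).trans (hFQ ω hω)
    calc |∫ ω, F ω - Q ω ∂μS| ≤ ∫ ω, |F ω - Q ω| ∂μS := abs_integral_le_integral_abs
      _ ≤ ∫ _, τ ∂μS := by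
          refine integral_mono_ae (hFiS.sub hQiS).abs (integrable_const τ) ?_
          exact haeS.mono fun ω hω => hFQ ω hω
      _ = τ := by simp
  -- (iii) the conditioning
  have hcond : |(∫ ω, Q ω ∂μS) - ∫ ω, Q ω ∂γ| ≤ 2 * (1 + ∫ ω, Q ω ^ 2 ∂γ) * Real.sqrt p := by
    rw [abs_sub_comm]
    exact abs_integral_sub_integral_cond_le_of_sq hS hQ hp hp2
  -- assemble
  rw [h1]
  calc |(∫ ω, F' ω ∂ν) - ∫ ω, Q ω ∂γ|
      = |((∫ ω, F' ω ∂ν) - ∫ ω, F' ω ∂μS) + ((∫ ω, F ω ∂μS) - ∫ ω, Q ω ∂μS) + ((∫ ω, Q ω ∂μS) - ∫ ω, Q ω ∂γ)| := by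
        rw [h2]; ring_nf
    _ ≤ |(∫ ω, F' ω ∂ν) - ∫ ω, F' ω ∂μS| + |(∫ ω, F ω ∂μS) - ∫ ω, Q ω ∂μS| + |(∫ ω, Q ω ∂μS) - ∫ ω, Q ω ∂γ| := by
        refine (abs_add_le _ _).trans ?_
        gcongr
        exact abs_add_le _ _
    _ ≤ M * (exp (2 * w) - 1) + τ + 2 * (1 + ∫ ω, Q ω ^ 2 ∂γ) * Real.sqrt p := by
        linarith [htilt, hsur, hcond]

end Summit.QuantumFields.YangMills.Theorems.WeakCouplingRates

end
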